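import Mathlib
import HarnessLib
import Literature.MathematicalPhysics.QuantumLattice.HeatKernelGroupGaugeProofs
import Literature.MathematicalPhysics.QuantumFieldTheory.ConstructiveQFTWave0Proofs
import Summits.Ventures.LatticeQCDFlow.Exactness.SU2MaskedKickEquivariance

/-!
# The conjugate-staple field transforms like a link: the engine's LO Wilson-flow member and its learned residual layers (invariant weights) are gauge-equivariant, on the nose

HONEST FRAMING: exact (Metropolis-corrected) sampling algorithms for lattice gauge theory;
figures of merit are autocorrelation/cost numbers at stated couplings and volumes; no
continuum-physics claim.

Venture `LatticeQCDFlow` (cell pub-lqcd), topic `Exactness`; FANOUT row 14 (`eng-flowhmc`, engine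
`latflow.fthmc`, family B — the "gauge-equivariant" field transformations `maps.wilson_flow_lo`
and `maps.resid_substep_flat` / `residual_trained_scan`).  NEW WORK of the cell; nothing is cited
as a fact; no number.  `SU2MaskedKickEquivariance.lean` proved: a masked `SU(2)` kick layer whose
local field transforms like a link (`quatVec (J (V^g) e) = g(x) · quatVec (J V e) · g(x+μ̂)ᴴ`) is
`IsGaugeEquivariant`, and left the path-ordered-product bookkeeping for the engine's actual fields
to a sequel.  This is that sequel.

## Content (statements about the explicit expressions of `SU2WilsonFlowLOSubstep.lean` / `SU2ResidualLayer.lean`; no definition)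

* torus bookkeeping (any `d`, `L`; shifts commute by the tree's `WilsonRP.shift_comm`):
  `sub_single_shift_comm`, `shift_sub_single_shift`;
* ANY GROUP `G`: `conjStapleUp_gaugeTransform`, `conjStapleDown_gaugeTransform` — the two
  conjugate staples through the link `(x, μ)` in the `(μ, ν)` plane,
  `A_ν⁻¹ = V(x,ν) V(x+ν̂,μ) V(x+μ̂,ν)⁻¹` and `B_ν⁻¹ = V(x−ν̂,ν)⁻¹ V(x−ν̂,μ) V(x−ν̂+μ̂,ν)`, transform
  like the link: `S(V^g) = g(x) · S(V) · g(x+μ̂)⁻¹`; `trace_plaquetteHolonomy_gaugeTransform`,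
  `isGaugeInvariant_tracePlaquetteFeatures` (`SU(n)`, any `n`): plaquette traces — the engine's
  conditioner features `(Re, Im) tr P` — are gauge INVARIANT;
* `SU(2)` in quaternion coordinates: `quatVec_vecQuat_coe`, `quatVec_sum`;
  **`quatVec_stapleJ_gaugeTransform`** — the LO field (conjugate staple sum) transforms like a
  link; **`quatVec_weightedStapleJ_gaugeTransform`** — so does the staple sum with ANY fixed real
  weights per `(ν, up/down)`;
* **`isGaugeEquivariant_su2WilsonFlowLOSubstep`** (any mask `p`) and `…_mask` (the engine's mask
  `(direction μ, colour class b)`): the masked `SU(2)` Wilson-flow Euler sub-step of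
  `su2WilsonFlowLOSubstep_certified`, LITERALLY, is `IsGaugeEquivariant`;
* **`isGaugeEquivariant_su2ResidualLayer`** — the learned residual layer of
  `su2ResidualLayer_certified`, LITERALLY, is `IsGaugeEquivariant` whenever its weights are gauge
  invariant at active links; **`isGaugeEquivariant_su2ResidualLayer_of_invariantFeatures`** — in
  particular for weights `Φ e ν s (features V)` computed by ANY maps `Φ` from ANY gauge-invariant
  feature map (e.g. the plaquette traces above: `…_of_traceFeatures`).

NOT CLAIMED: invariance of the booked Jacobian / the pulled-back Hamiltonian and member-level
(schedule) statements — the sequel `SU2MaskedKickJacobianInvariance.lean`; that a trained network's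
raw features are traces (the engine feeds `(Re, Im) tr P/N`; typed here as "any function of the
traces"); `SU(N ≥ 3)` kick layers; any number.
-/

noncomputable section

namespace Summit.Ventures.LatticeQCDFlow.Exactness

open Real WithLp
open Literature.MathematicalPhysics.QuantumFieldTheory
open scoped Matrix

variable {d L : ℕ}

/-! ## Torus bookkeeping -/

section Torus

/-- `(x − ν̂) + μ̂ = (x + μ̂) − ν̂`. -/
theorem sub_single_shift_comm (x : Site d L) (μ ν : Fin d) :
    (x - Pi.single ν 1).shift μ = x.shift μ - Pi.single ν 1 := by
  simp only [Site.shift, sub_add_eq_add_sub]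

/-- `(x − ν̂) + μ̂ + ν̂ = x + μ̂`. -/
theorem shift_sub_single_shift (x : Site d L) (μ ν : Fin d) :
    ((x - Pi.single ν 1).shift μ).shift ν = x.shift μ := by
  rw [sub_single_shift_comm, shift_sub_single]

end Torus

/-! ## Any group: the conjugate staples transform like the link -/

section AnyGroup

variable {G : Type*} [Group G]

/-- **The upper conjugate staple transforms like the link.**  For the link `(x, μ)` and `ν`:
`[V^g(x+μ̂,ν) V^g(x+ν̂,μ)⁻¹ V^g(x,ν)⁻¹]⁻¹ = g(x) · [V(x+μ̂,ν) V(x+ν̂,μ)⁻¹ V(x,ν)⁻¹]⁻¹ · g(x+μ̂)⁻¹`. -/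
theorem conjStapleUp_gaugeTransform (g : Site d L → G) (V : GaugeConfig d L G) (x : Site d L) (μ ν : Fin d) :
    ((gaugeTransform g V) (x.shift μ, ν) * ((gaugeTransform g V) (x.shift ν, μ))⁻¹ * ((gaugeTransform g V) (x, ν))⁻¹)⁻¹ =
      g x * (V (x.shift μ, ν) * (V (x.shift ν, μ))⁻¹ * (V (x, ν))⁻¹)⁻¹ * (g (x.shift μ))⁻¹ := by
  simp only [gaugeTransform, WilsonRP.shift_comm x ν μ, mul_inv_rev, inv_inv]
  group

/-- **The lower conjugate staple transforms like the link.**  For the link `(x, μ)` and `ν`: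
`[V^g(x−ν̂+μ̂,ν)⁻¹ V^g(x−ν̂,μ)⁻¹ V^g(x−ν̂,ν)]⁻¹ = g(x) · [V(x−ν̂+μ̂,ν)⁻¹ V(x−ν̂,μ)⁻¹ V(x−ν̂,ν)]⁻¹ · g(x+μ̂)⁻¹`. -/
theorem conjStapleDown_gaugeTransform (g : Site d L → G) (V : GaugeConfig d L G) (x : Site d L) (μ ν : Fin d) :
    (((gaugeTransform g V) ((x - Pi.single ν 1).shift μ, ν))⁻¹ * ((gaugeTransform g V) (x - Pi.single ν 1, μ))⁻¹ *
        (gaugeTransform g V) (x - Pi.single ν 1, ν))⁻¹ =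
      g x * ((V ((x - Pi.single ν 1).shift μ, ν))⁻¹ * (V (x - Pi.single ν 1, μ))⁻¹ * V (x - Pi.single ν 1, ν))⁻¹ *
        (g (x.shift μ))⁻¹ := by
  simp only [gaugeTransform, shift_sub_single_shift, shift_sub_single, mul_inv_rev, inv_inv]
  group

end AnyGroup

/-! ## `SU(n)`: plaquette traces are gauge invariant (the conditioner's features) -/

section Traces

variable {n : ℕ}

/-- `tr U_p(V^g) = tr U_p(V)`: the plaquette holonomy is conjugated at its base point
(`QuantumLattice.plaquetteHolonomy_gaugeTransform`) and the trace is cyclic. -/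
theorem trace_plaquetteHolonomy_gaugeTransform (g : Site d L → Matrix.specialUnitaryGroup (Fin n) ℂ)
    (V : GaugeConfig d L (Matrix.specialUnitaryGroup (Fin n) ℂ)) (x : Site d L) (i j : Fin d) :
    ((plaquetteHolonomy (gaugeTransform g V) x i j : Matrix.specialUnitaryGroup (Fin n) ℂ) : Matrix (Fin n) (Fin n) ℂ).trace =
      ((plaquetteHolonomy V x i j : Matrix.specialUnitaryGroup (Fin n) ℂ) : Matrix (Fin n) (Fin n) ℂ).trace := by
  rw [Literature.MathematicalPhysics.QuantumLattice.plaquetteHolonomy_gaugeTransform, WilsonFlow.coe_mul_SU,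
    WilsonFlow.coe_mul_SU, WilsonFlow.coe_inv_SU, Matrix.trace_mul_cycle, WilsonFlow.conjTranspose_mul_self_SU,
    Matrix.one_mul]

/-- **Plaquette-trace features are gauge invariant** — any family of plaquettes `(site i; m i, n i)`
(e.g. the frozen plaquettes of `FrozenPlaquetteFeatures.lean`), read through the trace: the
feature map `V ↦ (i ↦ tr U_{(site i; m i, n i)}(V))` is `IsGaugeInvariant`. -/
theorem isGaugeInvariant_tracePlaquetteFeatures {I : Type*} (site : I → Site d L) (m k : I → Fin d) :
    IsGaugeInvariant (fun (V : GaugeConfig d L (Matrix.specialUnitaryGroup (Fin n) ℂ)) (i : I) =>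
      ((plaquetteHolonomy V (site i) (m i) (k i) : Matrix.specialUnitaryGroup (Fin n) ℂ) : Matrix (Fin n) (Fin n) ℂ).trace) := by
  intro g V
  funext i
  exact trace_plaquetteHolonomy_gaugeTransform g V (site i) (m i) (k i)

end Traces

/-! ## `SU(2)` in quaternion coordinates -/

section Quaternion

/-- `quatVec (vecQuat U) = U` for `U ∈ SU(2)` (every `SU(2)` matrix is a quaternion). -/
theorem quatVec_vecQuat_coe (U : Matrix.specialUnitaryGroup (Fin 2) ℂ) :
    quatVec (vecQuat (U : Matrix (Fin 2) (Fin 2) ℂ)) = (U : Matrix (Fin 2) (Fin 2) ℂ) :=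
  quatVec_vecQuat (IsQuat.of_mem_specialUnitaryGroup U.2)

/-- `quatVec` is additive over finite sums. -/
theorem quatVec_sum {ι : Type*} (s : Finset ι) (f : ι → R4) :
    quatVec (∑ i ∈ s, f i) = ∑ i ∈ s, quatVec (f i) :=
  map_sum (AddMonoidHom.mk' quatVec quatVec_add) f s

end Quaternion

/-! ## The (weighted) conjugate-staple field transforms like a link -/

section Field

/-- **The LO Wilson-flow field transforms like a link.**  `J_e(V) = Σ_{ν ≠ μ} [vecQuat A_ν⁻¹ +
vecQuat B_ν⁻¹]` (the conjugate staple sum through `e = (x, μ)`, verbatim as in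
`SU2WilsonFlowLOSubstep.lean`) satisfies `quatVec (J_e(V^g)) = g(x) · quatVec (J_e(V)) · g(x+μ̂)ᴴ`. -/
theorem quatVec_stapleJ_gaugeTransform (g : Site d L → Matrix.specialUnitaryGroup (Fin 2) ℂ)
    (V : GaugeConfig d L (Matrix.specialUnitaryGroup (Fin 2) ℂ)) (e : Edge d L) :
    quatVec (∑ ν ∈ Finset.univ.erase e.2,
        (vecQuat ((((gaugeTransform g V) (Site.shift e.1 e.2, ν) * ((gaugeTransform g V) (Site.shift e.1 ν, e.2))⁻¹ * ((gaugeTransform g V) (e.1, ν))⁻¹)⁻¹ : Matrix.specialUnitaryGroup (Fin 2) ℂ) : Matrix (Fin 2) (Fin 2) ℂ) +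
          vecQuat (((((gaugeTransform g V) (Site.shift (e.1 - Pi.single ν 1) e.2, ν))⁻¹ * ((gaugeTransform g V) (e.1 - Pi.single ν 1, e.2))⁻¹ * (gaugeTransform g V) (e.1 - Pi.single ν 1, ν))⁻¹ : Matrix.specialUnitaryGroup (Fin 2) ℂ) : Matrix (Fin 2) (Fin 2) ℂ))) =
      (g e.1 : Matrix (Fin 2) (Fin 2) ℂ) *
        quatVec (∑ ν ∈ Finset.univ.erase e.2,
          (vecQuat (((V (Site.shift e.1 e.2, ν) * (V (Site.shift e.1 ν, e.2))⁻¹ * (V (e.1, ν))⁻¹)⁻¹ : Matrix.specialUnitaryGroup (Fin 2) ℂ) : Matrix (Fin 2) (Fin 2) ℂ) +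
            vecQuat ((((V (Site.shift (e.1 - Pi.single ν 1) e.2, ν))⁻¹ * (V (e.1 - Pi.single ν 1, e.2))⁻¹ * V (e.1 - Pi.single ν 1, ν))⁻¹ : Matrix.specialUnitaryGroup (Fin 2) ℂ) : Matrix (Fin 2) (Fin 2) ℂ))) *
        (g (e.1.shift e.2) : Matrix (Fin 2) (Fin 2) ℂ)ᴴ := by
  rw [quatVec_sum, quatVec_sum, Finset.mul_sum, Finset.sum_mul]
  refine Finset.sum_congr rfl fun ν _ => ?_
  rw [conjStapleUp_gaugeTransform g V e.1 e.2 ν, conjStapleDown_gaugeTransform g V e.1 e.2 ν]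
  simp only [quatVec_add, quatVec_vecQuat_coe]
  simp only [WilsonFlow.coe_mul_SU, WilsonFlow.coe_inv_SU, Matrix.mul_add, Matrix.add_mul]

/-- **The weighted conjugate-staple field transforms like a link**, for any fixed real weights
`a ν s` (`s = 0`: upper staple, `s = 1`: lower staple):
`quatVec (Σ_ν [a ν 0 • vecQuat A_ν⁻¹(V^g) + a ν 1 • vecQuat B_ν⁻¹(V^g)]) = g(x) · quatVec (Σ_ν [ … (V) … ]) · g(x+μ̂)ᴴ`. -/
theorem quatVec_weightedStapleJ_gaugeTransform (g : Site d L → Matrix.specialUnitaryGroup (Fin 2) ℂ)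
    (V : GaugeConfig d L (Matrix.specialUnitaryGroup (Fin 2) ℂ)) (e : Edge d L) (a : Fin d → Fin 2 → ℝ) :
    quatVec (∑ ν ∈ Finset.univ.erase e.2,
        (a ν 0 • vecQuat ((((gaugeTransform g V) (Site.shift e.1 e.2, ν) * ((gaugeTransform g V) (Site.shift e.1 ν, e.2))⁻¹ * ((gaugeTransform g V) (e.1, ν))⁻¹)⁻¹ : Matrix.specialUnitaryGroup (Fin 2) ℂ) : Matrix (Fin 2) (Fin 2) ℂ) +
          a ν 1 • vecQuat (((((gaugeTransform g V) (Site.shift (e.1 - Pi.single ν 1) e.2, ν))⁻¹ * ((gaugeTransform g V) (e.1 - Pi.single ν 1, e.2))⁻¹ * (gaugeTransform g V) (e.1 - Pi.single ν 1, ν))⁻¹ : Matrix.specialUnitaryGroup (Fin 2) ℂ) : Matrix (Fin 2) (Fin 2) ℂ))) =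
      (g e.1 : Matrix (Fin 2) (Fin 2) ℂ) *
        quatVec (∑ ν ∈ Finset.univ.erase e.2,
          (a ν 0 • vecQuat (((V (Site.shift e.1 e.2, ν) * (V (Site.shift e.1 ν, e.2))⁻¹ * (V (e.1, ν))⁻¹)⁻¹ : Matrix.specialUnitaryGroup (Fin 2) ℂ) : Matrix (Fin 2) (Fin 2) ℂ) +
            a ν 1 • vecQuat ((((V (Site.shift (e.1 - Pi.single ν 1) e.2, ν))⁻¹ * (V (e.1 - Pi.single ν 1, e.2))⁻¹ * V (e.1 - Pi.single ν 1, ν))⁻¹ : Matrix.specialUnitaryGroup (Fin 2) ℂ) : Matrix (Fin 2) (Fin 2) ℂ))) *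
        (g (e.1.shift e.2) : Matrix (Fin 2) (Fin 2) ℂ)ᴴ := by
  rw [quatVec_sum, quatVec_sum, Finset.mul_sum, Finset.sum_mul]
  refine Finset.sum_congr rfl fun ν _ => ?_
  rw [conjStapleUp_gaugeTransform g V e.1 e.2 ν, conjStapleDown_gaugeTransform g V e.1 e.2 ν]
  simp only [quatVec_add, quatVec_smul, quatVec_vecQuat_coe]
  simp only [WilsonFlow.coe_mul_SU, WilsonFlow.coe_inv_SU, Matrix.mul_add, Matrix.add_mul, Matrix.mul_smul,
    Matrix.smul_mul]

end Field

/-! ## The LO member is gauge equivariant -/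

section LO

/-- **The masked `SU(2)` Wilson-flow Euler sub-step is gauge equivariant** (any mask `p`, any
step `ε`): kicking the active links towards their conjugate staple sums commutes with every gauge
transformation, `F(V^g) = F(V)^g`. -/
theorem isGaugeEquivariant_su2WilsonFlowLOSubstep (p : Edge d L → Prop) [DecidablePred p] (ε : ℝ) :
    IsGaugeEquivariant (fun (V : GaugeConfig d L (Matrix.specialUnitaryGroup (Fin 2) ℂ)) (e : Edge d L) =>
      if p e then
        gaussUnit (geodesicKick ε (∑ ν ∈ Finset.univ.erase e.2,
          (vecQuat (((V (Site.shift e.1 e.2, ν) * (V (Site.shift e.1 ν, e.2))⁻¹ * (V (e.1, ν))⁻¹)⁻¹ : Matrix.specialUnitaryGroup (Fin 2) ℂ) : Matrix (Fin 2) (Fin 2) ℂ) +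
            vecQuat ((((V (Site.shift (e.1 - Pi.single ν 1) e.2, ν))⁻¹ * (V (e.1 - Pi.single ν 1, e.2))⁻¹ * V (e.1 - Pi.single ν 1, ν))⁻¹ : Matrix.specialUnitaryGroup (Fin 2) ℂ) : Matrix (Fin 2) (Fin 2) ℂ)))
          (vecQuat ((V e : Matrix.specialUnitaryGroup (Fin 2) ℂ) : Matrix (Fin 2) (Fin 2) ℂ)))
      else V e) :=
  isGaugeEquivariant_su2MaskedKick p
    (fun (V : GaugeConfig d L (Matrix.specialUnitaryGroup (Fin 2) ℂ)) (e : Edge d L) => ∑ ν ∈ Finset.univ.erase e.2,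
      (vecQuat (((V (Site.shift e.1 e.2, ν) * (V (Site.shift e.1 ν, e.2))⁻¹ * (V (e.1, ν))⁻¹)⁻¹ : Matrix.specialUnitaryGroup (Fin 2) ℂ) : Matrix (Fin 2) (Fin 2) ℂ) +
        vecQuat ((((V (Site.shift (e.1 - Pi.single ν 1) e.2, ν))⁻¹ * (V (e.1 - Pi.single ν 1, e.2))⁻¹ * V (e.1 - Pi.single ν 1, ν))⁻¹ : Matrix.specialUnitaryGroup (Fin 2) ℂ) : Matrix (Fin 2) (Fin 2) ℂ)))
    (fun g V e _ => quatVec_stapleJ_gaugeTransform g V e)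

variable {X : Type*} [DecidableEq X] (χ : Site d L → X)

/-- **The engine's sub-step `(direction μ, colour class b)` of `su2WilsonFlowLOSubstep_certified`,
verbatim, is gauge equivariant** (for every colouring `χ`, proper or not, and every `ε`). -/
theorem isGaugeEquivariant_su2WilsonFlowLOSubstep_mask (μ : Fin d) (b : X) (ε : ℝ) :
    IsGaugeEquivariant (fun (V : GaugeConfig d L (Matrix.specialUnitaryGroup (Fin 2) ℂ)) (e : Edge d L) =>
      if e.2 = μ ∧ χ e.1 = b then
        gaussUnit (geodesicKick ε (∑ ν ∈ Finset.univ.erase e.2,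
          (vecQuat (((V (Site.shift e.1 e.2, ν) * (V (Site.shift e.1 ν, e.2))⁻¹ * (V (e.1, ν))⁻¹)⁻¹ : Matrix.specialUnitaryGroup (Fin 2) ℂ) : Matrix (Fin 2) (Fin 2) ℂ) +
            vecQuat ((((V (Site.shift (e.1 - Pi.single ν 1) e.2, ν))⁻¹ * (V (e.1 - Pi.single ν 1, e.2))⁻¹ * V (e.1 - Pi.single ν 1, ν))⁻¹ : Matrix.specialUnitaryGroup (Fin 2) ℂ) : Matrix (Fin 2) (Fin 2) ℂ)))
          (vecQuat ((V e : Matrix.specialUnitaryGroup (Fin 2) ℂ) : Matrix (Fin 2) (Fin 2) ℂ)))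
      else V e) :=
  isGaugeEquivariant_su2WilsonFlowLOSubstep (fun e : Edge d L => e.2 = μ ∧ χ e.1 = b) ε

end LO

/-! ## The learned residual layers are gauge equivariant (invariant weights) -/

section Residual

/-- **The engine's learned `SU(2)` residual layer of `su2ResidualLayer_certified`, verbatim, is
gauge equivariant whenever its staple weights are gauge invariant at active links**
(`ρ (V^g) e ν s = ρ V e ν s` for active `e`): any mask `p`, any step constant `c`. -/
theorem isGaugeEquivariant_su2ResidualLayer (p : Edge d L → Prop) [DecidablePred p] (c : ℝ)
    (ρ : GaugeConfig d L (Matrix.specialUnitaryGroup (Fin 2) ℂ) → Edge d L → Fin d → Fin 2 → ℝ)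
    (hρ : ∀ (g : Site d L → Matrix.specialUnitaryGroup (Fin 2) ℂ)
      (V : GaugeConfig d L (Matrix.specialUnitaryGroup (Fin 2) ℂ)) (e : Edge d L), p e →
        ∀ ν s, ρ (gaugeTransform g V) e ν s = ρ V e ν s) :
    IsGaugeEquivariant (fun (V : GaugeConfig d L (Matrix.specialUnitaryGroup (Fin 2) ℂ)) (e : Edge d L) =>
      if p e then
        gaussUnit (geodesicKick c (∑ ν ∈ Finset.univ.erase e.2,
          (ρ V e ν 0 • vecQuat (((V (Site.shift e.1 e.2, ν) * (V (Site.shift e.1 ν, e.2))⁻¹ * (V (e.1, ν))⁻¹)⁻¹ : Matrix.specialUnitaryGroup (Fin 2) ℂ) : Matrix (Fin 2) (Fin 2) ℂ) +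
            ρ V e ν 1 • vecQuat ((((V (Site.shift (e.1 - Pi.single ν 1) e.2, ν))⁻¹ * (V (e.1 - Pi.single ν 1, e.2))⁻¹ * V (e.1 - Pi.single ν 1, ν))⁻¹ : Matrix.specialUnitaryGroup (Fin 2) ℂ) : Matrix (Fin 2) (Fin 2) ℂ)))
          (vecQuat ((V e : Matrix.specialUnitaryGroup (Fin 2) ℂ) : Matrix (Fin 2) (Fin 2) ℂ)))
      else V e) := by
  refine isGaugeEquivariant_su2MaskedKick p
    (fun (V : GaugeConfig d L (Matrix.specialUnitaryGroup (Fin 2) ℂ)) (e : Edge d L) => ∑ ν ∈ Finset.univ.erase e.2,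
      (ρ V e ν 0 • vecQuat (((V (Site.shift e.1 e.2, ν) * (V (Site.shift e.1 ν, e.2))⁻¹ * (V (e.1, ν))⁻¹)⁻¹ : Matrix.specialUnitaryGroup (Fin 2) ℂ) : Matrix (Fin 2) (Fin 2) ℂ) +
        ρ V e ν 1 • vecQuat ((((V (Site.shift (e.1 - Pi.single ν 1) e.2, ν))⁻¹ * (V (e.1 - Pi.single ν 1, e.2))⁻¹ * V (e.1 - Pi.single ν 1, ν))⁻¹ : Matrix.specialUnitaryGroup (Fin 2) ℂ) : Matrix (Fin 2) (Fin 2) ℂ)))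
    (fun g V e he => ?_)
  have hw : (∑ ν ∈ Finset.univ.erase e.2,
      (ρ (gaugeTransform g V) e ν 0 • vecQuat ((((gaugeTransform g V) (Site.shift e.1 e.2, ν) * ((gaugeTransform g V) (Site.shift e.1 ν, e.2))⁻¹ * ((gaugeTransform g V) (e.1, ν))⁻¹)⁻¹ : Matrix.specialUnitaryGroup (Fin 2) ℂ) : Matrix (Fin 2) (Fin 2) ℂ) +
        ρ (gaugeTransform g V) e ν 1 • vecQuat (((((gaugeTransform g V) (Site.shift (e.1 - Pi.single ν 1) e.2, ν))⁻¹ * ((gaugeTransform g V) (e.1 - Pi.single ν 1, e.2))⁻¹ * (gaugeTransform g V) (e.1 - Pi.single ν 1, ν))⁻¹ : Matrix.specialUnitaryGroup (Fin 2) ℂ) : Matrix (Fin 2) (Fin 2) ℂ))) =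
      ∑ ν ∈ Finset.univ.erase e.2,
      ((fun ν s => ρ V e ν s) ν 0 • vecQuat ((((gaugeTransform g V) (Site.shift e.1 e.2, ν) * ((gaugeTransform g V) (Site.shift e.1 ν, e.2))⁻¹ * ((gaugeTransform g V) (e.1, ν))⁻¹)⁻¹ : Matrix.specialUnitaryGroup (Fin 2) ℂ) : Matrix (Fin 2) (Fin 2) ℂ) +
        (fun ν s => ρ V e ν s) ν 1 • vecQuat (((((gaugeTransform g V) (Site.shift (e.1 - Pi.single ν 1) e.2, ν))⁻¹ * ((gaugeTransform g V) (e.1 - Pi.single ν 1, e.2))⁻¹ * (gaugeTransform g V) (e.1 - Pi.single ν 1, ν))⁻¹ : Matrix.specialUnitaryGroup (Fin 2) ℂ) : Matrix (Fin 2) (Fin 2) ℂ)) :=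
    Finset.sum_congr rfl fun ν _ => by rw [hρ g V e he ν 0, hρ g V e he ν 1]
  rw [hw]
  exact quatVec_weightedStapleJ_gaugeTransform g V e (fun ν s => ρ V e ν s)

/-- **Learned layers conditioned on gauge-invariant features are gauge equivariant.**  If the
weights are `ρ V e ν s = Φ e ν s (feat V)` for ANY maps `Φ` and ANY gauge-invariant feature map
`feat` (`IsGaugeInvariant feat`), the residual layer is `IsGaugeEquivariant` — any mask, any `c`. -/
theorem isGaugeEquivariant_su2ResidualLayer_of_invariantFeatures (p : Edge d L → Prop) [DecidablePred p] (c : ℝ)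
    {F : Type*} (feat : GaugeConfig d L (Matrix.specialUnitaryGroup (Fin 2) ℂ) → F) (hfeat : IsGaugeInvariant feat)
    (Φ : Edge d L → Fin d → Fin 2 → F → ℝ) :
    IsGaugeEquivariant (fun (V : GaugeConfig d L (Matrix.specialUnitaryGroup (Fin 2) ℂ)) (e : Edge d L) =>
      if p e then
        gaussUnit (geodesicKick c (∑ ν ∈ Finset.univ.erase e.2,
          (Φ e ν 0 (feat V) • vecQuat (((V (Site.shift e.1 e.2, ν) * (V (Site.shift e.1 ν, e.2))⁻¹ * (V (e.1, ν))⁻¹)⁻¹ : Matrix.specialUnitaryGroup (Fin 2) ℂ) : Matrix (Fin 2) (Fin 2) ℂ) +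
            Φ e ν 1 (feat V) • vecQuat ((((V (Site.shift (e.1 - Pi.single ν 1) e.2, ν))⁻¹ * (V (e.1 - Pi.single ν 1, e.2))⁻¹ * V (e.1 - Pi.single ν 1, ν))⁻¹ : Matrix.specialUnitaryGroup (Fin 2) ℂ) : Matrix (Fin 2) (Fin 2) ℂ)))
          (vecQuat ((V e : Matrix.specialUnitaryGroup (Fin 2) ℂ) : Matrix (Fin 2) (Fin 2) ℂ)))
      else V e) :=
  isGaugeEquivariant_su2ResidualLayer p c (fun V e ν s => Φ e ν s (feat V))
    (fun g V e _ ν s => by rw [hfeat g V])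

variable {X : Type*} [DecidableEq X] (χ : Site d L → X)

/-- **The engine's case: weights computed from plaquette TRACES are invariant, so the learned
layer `(μ, b)` is gauge equivariant** — for ANY family of plaquettes `(site i; m i, k i)` (e.g. the
frozen plaquettes of the `(μ, b)` mask) and ANY maps `Φ e ν s` from their traces to the weights
(e.g. a CNN on `(Re, Im) tr` followed by the `(κ/J_n) tanh` squashing). -/
theorem isGaugeEquivariant_su2ResidualLayer_of_traceFeatures (μ : Fin d) (b : X) (c : ℝ) {I : Type*}
    (site : I → Site d L) (m k : I → Fin d) (Φ : Edge d L → Fin d → Fin 2 → (I → ℂ) → ℝ) :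
    IsGaugeEquivariant (fun (V : GaugeConfig d L (Matrix.specialUnitaryGroup (Fin 2) ℂ)) (e : Edge d L) =>
      if e.2 = μ ∧ χ e.1 = b then
        gaussUnit (geodesicKick c (∑ ν ∈ Finset.univ.erase e.2,
          (Φ e ν 0 (fun i : I => ((plaquetteHolonomy V (site i) (m i) (k i) : Matrix.specialUnitaryGroup (Fin 2) ℂ) : Matrix (Fin 2) (Fin 2) ℂ).trace) •
              vecQuat (((V (Site.shift e.1 e.2, ν) * (V (Site.shift e.1 ν, e.2))⁻¹ * (V (e.1, ν))⁻¹)⁻¹ : Matrix.specialUnitaryGroup (Fin 2) ℂ) : Matrix (Fin 2) (Fin 2) ℂ) +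
            Φ e ν 1 (fun i : I => ((plaquetteHolonomy V (site i) (m i) (k i) : Matrix.specialUnitaryGroup (Fin 2) ℂ) : Matrix (Fin 2) (Fin 2) ℂ).trace) •
              vecQuat ((((V (Site.shift (e.1 - Pi.single ν 1) e.2, ν))⁻¹ * (V (e.1 - Pi.single ν 1, e.2))⁻¹ * V (e.1 - Pi.single ν 1, ν))⁻¹ : Matrix.specialUnitaryGroup (Fin 2) ℂ) : Matrix (Fin 2) (Fin 2) ℂ)))
          (vecQuat ((V e : Matrix.specialUnitaryGroup (Fin 2) ℂ) : Matrix (Fin 2) (Fin 2) ℂ)))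
      else V e) :=
  isGaugeEquivariant_su2ResidualLayer_of_invariantFeatures (fun e : Edge d L => e.2 = μ ∧ χ e.1 = b) c
    (fun (V : GaugeConfig d L (Matrix.specialUnitaryGroup (Fin 2) ℂ)) (i : I) =>
      ((plaquetteHolonomy V (site i) (m i) (k i) : Matrix.specialUnitaryGroup (Fin 2) ℂ) : Matrix (Fin 2) (Fin 2) ℂ).trace)
    (isGaugeInvariant_tracePlaquetteFeatures site m k) Φ

end Residual

end Summit.Ventures.LatticeQCDFlow.Exactness
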